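import Mathlib
import Summits.ValiantsHypothesis.ValiantsHypothesis.Theorems.KPlusLogSqLawTropicalBSplitDefs
import Summits.ValiantsHypothesis.ValiantsHypothesis.Theorems.KPlusLogSqLawTropicalBTwoSidedSeparableRows

/-!
# Route «KPlusLogSqLaw», crux `TropicalB` (stmt-ValiantsHypothesis-19771) — THE TWO-SIDED SEPARABLE SECTOR, part 5: the law in the
# census currency `DesignRowD` (unsigned row bound of ONE design)

HONEST FRAMING.  Helper toward the registered stubs `stub_tropThin` / `stub_tropFat` of `Cruxes/TropicalB/Lines/birth.lean` (crux
`Summit.ValiantsHypothesis.ValiantsHypothesis.Theses.KPlusLogSqLaw.TropicalB`, item stmt-ValiantsHypothesis-19771, route KPlusLogSqLaw;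
cell `pub-symmetroid`, seat val-sym-trop-p1 g19, 2026-08-28; `--supports … --as helper`).  Repackaging of parts 3–4
(`…TwoSidedSeparable`, `…TwoSidedSeparableRows`) in the cell's census vocabulary `DesignRowD d v ε B` (`…TropicalBSplitDefs`: every chain of
unique optima of the design `(d, v, ε)` at strictly increasing integer slopes with consecutive terms distinct has at most `B` breakpoints).
SECTOR statements only (two-sided separable designs with a fine tie-break); nothing here bounds `TropicalB` for general designs, and nothing
bears on `WeakLifting`, DoorA26 / DoorA34, `MatrixDescartes` (stmt-ValiantsHypothesis-18050) or VP ≠ VNP.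

* `designRowD_of_signEquiv` — sector + a sign-equivalent potential `u` with `0 ≤ u ≤ U` ⇒ `DesignRowD d v ε (m·U)`;
* `designRowD_three` — `K = 3`, `e 0 < e 1 < e 2` ⇒ `DesignRowD d v ε (2m)`;
* `designRowD_four` — `K = 4`, `e` strictly increasing ⇒ `DesignRowD d v ε (4m)`;
* `designRowD_domDigit` — dominant digits ⇒ `DesignRowD d v ε (m·(2^(K−1) − 1))`.
[this file: bookkeeping over parts 3–4]
-/

set_option linter.dupNamespace false
set_option autoImplicit false

namespace Summit.ValiantsHypothesis.ValiantsHypothesis.Theorems.KPlusLogSqLaw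

namespace TwoSided

open Summit.ValiantsHypothesis.ValiantsHypothesis.Theorems.MatrixDescartes.Negative
open scoped BigOperators
open Finset

variable {m K : ℕ}

/-- **The sector law as an unsigned design row**: `DesignRowD d v ε (m·U)` for any sign-equivalent potential with values in `[0, U]`.
[this file] -/
theorem designRowD_of_signEquiv (e : Fin K → ℕ) (M : ℕ) (d : Fin K → ℕ) (hd : ∀ l, d l = M * e l)
    (r c : Fin m → Fin K → ℤ) (w : Fin m → Fin m → ℤ) (B : ℤ)
    (hw0 : ∀ a b, 0 ≤ w a b) (hwB : ∀ a b, w a b ≤ B) (hMB : (m : ℤ) * B < M)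
    (v ε : Fin m → Fin m → Fin K → ℤ) (hv : ∀ a b l, v a b l = (M : ℤ) * (r a l + c b l) + w a b)
    (hε : ∀ a b l, ε a b l ≠ 0) (u : Fin K → ℤ)
    (hu : ∀ z : Fin K → ℤ, (∀ l, z l = -1 ∨ z l = 0 ∨ z l = 1) → ∑ l, z l = 0 →
      (0 ≤ ∑ l, (e l : ℤ) * z l → 0 ≤ ∑ l, u l * z l) ∧ (0 < ∑ l, (e l : ℤ) * z l → 0 < ∑ l, u l * z l))
    (U : ℕ) (hU : ∀ l, 0 ≤ u l ∧ u l ≤ U) : DesignRowD d v ε (m * U) := by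
  intro n θ p hθ hdom hne
  have h := chain_le e M d hd r c w B hw0 hwB hMB v ε hv hε u hu 0 U (fun l => ⟨(hU l).1, (hU l).2⟩) θ p hθ hdom hne
  have : (n : ℤ) ≤ m * U := by simpa using h
  exact_mod_cast this

/-- **`K = 3` census row of the sector**: `DesignRowD d v ε (2m)`. [this file] -/
theorem designRowD_three (e : Fin 3 → ℕ) (h01 : e 0 < e 1) (h12 : e 1 < e 2) (M : ℕ) (d : Fin 3 → ℕ)
    (hd : ∀ l, d l = M * e l) (r c : Fin m → Fin 3 → ℤ) (w : Fin m → Fin m → ℤ) (B : ℤ)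
    (hw0 : ∀ a b, 0 ≤ w a b) (hwB : ∀ a b, w a b ≤ B) (hMB : (m : ℤ) * B < M)
    (v ε : Fin m → Fin m → Fin 3 → ℤ) (hv : ∀ a b l, v a b l = (M : ℤ) * (r a l + c b l) + w a b)
    (hε : ∀ a b l, ε a b l ≠ 0) : DesignRowD d v ε (2 * m) := by
  have h := designRowD_of_signEquiv e M d hd r c w B hw0 hwB hMB v ε hv hε (fun l => ((l : ℕ) : ℤ))
    (signEquiv_three e h01 h12) 2 (fun l => ⟨by positivity, by have := l.isLt; omega⟩)
  rwa [mul_comm] at h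

/-- **`K = 4` census row of the sector**: `DesignRowD d v ε (4m)`. [this file] -/
theorem designRowD_four (e : Fin 4 → ℕ) (h01 : e 0 < e 1) (h12 : e 1 < e 2) (h23 : e 2 < e 3) (M : ℕ) (d : Fin 4 → ℕ)
    (hd : ∀ l, d l = M * e l) (r c : Fin m → Fin 4 → ℤ) (w : Fin m → Fin m → ℤ) (B : ℤ)
    (hw0 : ∀ a b, 0 ≤ w a b) (hwB : ∀ a b, w a b ≤ B) (hMB : (m : ℤ) * B < M)
    (v ε : Fin m → Fin m → Fin 4 → ℤ) (hv : ∀ a b l, v a b l = (M : ℤ) * (r a l + c b l) + w a b)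
    (hε : ∀ a b l, ε a b l ≠ 0) : DesignRowD d v ε (4 * m) := by
  intro n θ p hθ hdom hne
  rcases lt_trichotomy (e 1 + e 2) (e 0 + e 3) with hc | hc | hc
  · have h := designRowD_of_signEquiv e M d hd r c w B hw0 hwB hMB v ε hv hε _ (signEquiv_four_convex e h01 h12 h23 hc) 4
      (fun l => by fin_cases l <;> simp) n θ p hθ hdom hne
    omega
  · have h := designRowD_of_signEquiv e M d hd r c w B hw0 hwB hMB v ε hv hε _ (signEquiv_four_flat e h01 h12 h23 hc.symm) 3
      (fun l => by fin_cases l <;> simp) n θ p hθ hdom hne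
    omega
  · have h := designRowD_of_signEquiv e M d hd r c w B hw0 hwB hMB v ε hv hε _ (signEquiv_four_concave e h01 h12 h23 hc) 4
      (fun l => by fin_cases l <;> simp) n θ p hθ hdom hne
    omega

/-- **Dominant-digit census row of the sector**: `DesignRowD d v ε (m·(2^(K−1) − 1))`. [this file] -/
theorem designRowD_domDigit (e : Fin K → ℕ) (hdd : ∀ l : Fin K, (∑ j : Fin K, if j < l then (e j : ℤ) else 0) < e l)
    (M : ℕ) (d : Fin K → ℕ) (hd : ∀ l, d l = M * e l)
    (r c : Fin m → Fin K → ℤ) (w : Fin m → Fin m → ℤ) (B : ℤ)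
    (hw0 : ∀ a b, 0 ≤ w a b) (hwB : ∀ a b, w a b ≤ B) (hMB : (m : ℤ) * B < M)
    (v ε : Fin m → Fin m → Fin K → ℤ) (hv : ∀ a b l, v a b l = (M : ℤ) * (r a l + c b l) + w a b)
    (hε : ∀ a b l, ε a b l ≠ 0) : DesignRowD d v ε (m * (2 ^ (K - 1) - 1)) := by
  intro n θ p hθ hdom hne
  have h := chain_le e M d hd r c w B hw0 hwB hMB v ε hv hε (fun l => (2 : ℤ) ^ (l : ℕ)) (signEquiv_domDigit e hdd) 1
    ((2 : ℤ) ^ (K - 1)) (fun l => ⟨one_le_pow₀ (by norm_num), pow_le_pow_right₀ (by norm_num) (by have := l.isLt; omega)⟩)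
    θ p hθ hdom hne
  have h1 : (1 : ℤ) ≤ 2 ^ (K - 1) := one_le_pow₀ (by norm_num)
  have h2 : ((m * (2 ^ (K - 1) - 1) : ℕ) : ℤ) = (m : ℤ) * ((2 : ℤ) ^ (K - 1) - 1) := by
    have : 1 ≤ 2 ^ (K - 1) := Nat.one_le_two_pow
    push_cast [Nat.sub_one, this]
    simp [Nat.cast_sub this]
  have : (n : ℤ) ≤ ((m * (2 ^ (K - 1) - 1) : ℕ) : ℤ) := by rw [h2]; exact h
  exact_mod_cast this

end TwoSided

end Summit.ValiantsHypothesis.ValiantsHypothesis.Theorems.KPlusLogSqLaw
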